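import Mathlib
import HarnessLib
import Summits.ResolutionOfSingularities.ResolutionOfSingularities.Theorems.WildQuotientsWildQuotientResolutionS1aPrincipalAugmentationTerminal
import Summits.ResolutionOfSingularities.ResolutionOfSingularities.Theorems.WildQuotientsWildQuotientResolutionS1aPrincipalAugmentationKillsZero
import Summits.ResolutionOfSingularities.ResolutionOfSingularities.Theorems.WildQuotientsWildQuotientResolutionS1aGraphTailAux

/-!
# S1a — DEPTH-0 KILLS from the DATUM's order hypothesis `g₀ ^ p = 1` (census-ready forms)

[OURS · L1 W4.5c · leafhand-res-wildquotients-9 g1] — NOT statements of the manuscript; counted 0; AI-level work, weaker than expert review. Crux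
stmt-ResolutionOfSingularities-17941 `CyclicQuotientFourfolds`, line `s1a-logminvertex` v13 (`stub_reachLowerInFX`).

The depth-0 theorems ✓`terminal_initial_of_isPrincipal_augmentationIdeal(_mvPolynomial)` and ✓`killsIn_zero_initial_of_isPrincipal_augmentationIdeal`
carry the order hypothesis as `σ^[p] = id` on the model ring; the census data carry it as `g₀ ^ p = 1` on the group element. This file bridges the two
with the tree's ✓`iterate_eq_self_of_chart` (`…S1aGraphTailAux`, on the chart `⊤` of the initial model):
* `iterate_eq_self_of_topChart` — the `appLE`-form: `e : Γ(X′, ⊤) ≃+* K` intertwining `g₀` with `σ` and `g₀ ^ p = 1` ⇒ `σ^[p] = id`;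
* `terminal_initial_of_isPrincipal_augmentationIdeal_of_pow`, `killsIn_zero_initial_of_isPrincipal_augmentationIdeal_of_pow` — the census-ready forms
  (polynomial chart `k[x_ι]`, `σ` fixing constants, `g₀ ^ p = 1`, principal augmentation ideal ⇒ TERMINAL, resp. `KillsIn 0`).
-/

set_option linter.dupNamespace false

noncomputable section

open CategoryTheory Limits AlgebraicGeometry TopologicalSpace Topology MvPolynomial
open Literature.AlgebraicGeometry.Resolution Literature.AlgebraicGeometry.RelativeSpec
open Summit.ResolutionOfSingularities.ResolutionOfSingularities.Theorems.WildQuotientResolution.S1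
open Summit.ResolutionOfSingularities.ResolutionOfSingularities.Theorems.WildQuotientResolution.S1.NodeAtlas
open Summit.ResolutionOfSingularities.ResolutionOfSingularities.Theorems.WildQuotientResolution.S1.NpFrame
open Summit.ResolutionOfSingularities.ResolutionOfSingularities.Theorems.WildQuotientResolution.S1.GoodCharts

namespace Summit.ResolutionOfSingularities.ResolutionOfSingularities.Theorems.WildQuotientResolution.S1.GameFrame.GModel

variable {p : ℕ} {X' X₁ : Scheme.{0}} {q : X' ⟶ X₁} {G : Type} [Group G] {ρ : G →* Aut X'} {g₀ : G}

/-- **`σ^[p] = id` from `g₀ ^ p = 1`, `appLE` form on the chart `⊤`** (✓`iterate_eq_self_of_chart` for the initial model and `O = X′`).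
[OURS · L1 W4.5c; folklore] -/
theorem iterate_eq_self_of_topChart (hq : ∀ g : G, (ρ g).hom ≫ q = q) [IsIntegral X'] [IsLocallyNoetherian X'] [IsAffine X'] [IsAffineHom q]
    {K : Type} [CommRing K] (σ : K ≃+* K) (e : Γ(X', ⊤) ≃+* K)
    (he : ∀ t : Γ(X', ⊤), e ((ρ g₀⁻¹).hom.appLE ⊤ ⊤ (by rw [Scheme.Hom.preimage_top]) t) = σ (e t))
    (hg₀ : g₀ ^ p = 1) (h₀ : NodeAtlas p (⟨ρ, hq⟩ : ActionOver q G) g₀) (a : K) : (⇑σ)^[p] a = a := by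
  haveI : IsAffine (⊤ : X'.Opens) := isAffineOpen_top X'
  have hAff : IsAffineHom ((⊤ : X'.Opens).ι ≫ q) := inferInstance
  have hst : ∀ g : G, (ρ g).hom ⁻¹ᵁ (⊤ : X'.Opens) = ⊤ := fun g => Scheme.Hom.preimage_top _
  let M : GModel p q G ρ g₀ := GModel.initial (p := p) (g₀ := g₀) hq h₀
  let O : M.act.StableAffineOpens := ⟨⊤, hst, hAff⟩
  have hact : ∀ t : Γ(M.V, O.1), actOEquiv M.act O g₀ t = e.symm (σ (e t)) := fun t => by
    apply e.injective
    rw [e.apply_symm_apply, ← he]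
    rfl
  exact iterate_eq_self_of_chart M O hg₀ e σ hact a

/-- ★ **Census-ready depth-0 kill, TERMINAL form**: polynomial chart `e : Γ(X′, ⊤) ≃+* k[x_ι]` intertwining `g₀` with `σ` fixing constants, `g₀ ^ p = 1`
(`p` prime), `augmentationIdeal σ` principal ⇒ the initial model is TERMINAL. [OURS · L1 W4.5c · depth-0 kill; NOT a statement of the manuscript] -/
theorem terminal_initial_of_isPrincipal_augmentationIdeal_of_pow [Finite G] (hG : ∀ g : G, g ∈ Subgroup.zpowers g₀) (hg₀ : g₀ ^ p = 1)
    (hq : ∀ g : G, (ρ g).hom ≫ q = q) [IsIntegral X'] [IsLocallyNoetherian X'] [IsAffine X'] [IsAffineHom q]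
    {k : Type} [Field k] {ι : Type} [Finite ι] (σ : MvPolynomial ι k ≃+* MvPolynomial ι k) (hC : ∀ a : k, σ (C a) = C a)
    (hp : p.Prime) (hI : (augmentationIdeal σ).IsPrincipal)
    (e : Γ(X', ⊤) ≃+* MvPolynomial ι k)
    (he : ∀ t : Γ(X', ⊤), e ((ρ g₀⁻¹).hom.appLE ⊤ ⊤ (by rw [Scheme.Hom.preimage_top]) t) = σ (e t))
    (h₀ : NodeAtlas p (⟨ρ, hq⟩ : ActionOver q G) g₀) :
    (GModel.initial (p := p) (g₀ := g₀) hq h₀).Terminal :=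
  terminal_initial_of_isPrincipal_augmentationIdeal_mvPolynomial hG hq σ hC hp
    (iterate_eq_self_of_topChart (p := p) hq σ e he hg₀ h₀) hI e he h₀

/-- ★ **Census-ready depth-0 kill, `F = ∅` form**: the same hypotheses (`ι` a `Fintype`) ⇒ `KillsIn 0 (initial)`.
[OURS · L1 W4.5c · depth-0 kill; NOT a statement of the manuscript] -/
theorem killsIn_zero_initial_of_isPrincipal_augmentationIdeal_of_pow [Finite G] (hG : ∀ g : G, g ∈ Subgroup.zpowers g₀) (hg₀ : g₀ ^ p = 1)
    (hq : ∀ g : G, (ρ g).hom ≫ q = q) [IsIntegral X'] [IsLocallyNoetherian X'] [IsAffine X'] [IsAffineHom q]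
    {k : Type} [Field k] {ι : Type} [Fintype ι] [DecidableEq ι] (σ : MvPolynomial ι k ≃+* MvPolynomial ι k)
    (hI : (augmentationIdeal σ).IsPrincipal)
    (e : Γ(X', ⊤) ≃+* MvPolynomial ι k)
    (he : ∀ t : Γ(X', ⊤), e ((ρ g₀⁻¹).hom.appLE ⊤ ⊤ (by rw [Scheme.Hom.preimage_top]) t) = σ (e t))
    (h₀ : NodeAtlas p (⟨ρ, hq⟩ : ActionOver q G) g₀) :
    KillsIn 0 (GModel.initial (p := p) (g₀ := g₀) hq h₀) :=
  killsIn_zero_initial_of_isPrincipal_augmentationIdeal hG hq σ (iterate_eq_self_of_topChart (p := p) hq σ e he hg₀ h₀) hI e he h₀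

/-- **… and the research-stub clause** (every root decoration). [OURS · L1 W4.5c · depth-0 kill; NOT a statement of the manuscript] -/
theorem exists_reachLowerF_initial_of_isPrincipal_augmentationIdeal_of_pow [Finite G] (hG : ∀ g : G, g ∈ Subgroup.zpowers g₀) (hg₀ : g₀ ^ p = 1)
    (hq : ∀ g : G, (ρ g).hom ≫ q = q) [IsIntegral X'] [IsLocallyNoetherian X'] [IsAffine X'] [IsAffineHom q]
    {k : Type} [Field k] {ι : Type} [Finite ι] (σ : MvPolynomial ι k ≃+* MvPolynomial ι k) (hC : ∀ a : k, σ (C a) = C a)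
    (hp : p.Prime) (hI : (augmentationIdeal σ).IsPrincipal)
    (e : Γ(X', ⊤) ≃+* MvPolynomial ι k)
    (he : ∀ t : Γ(X', ⊤), e ((ρ g₀⁻¹).hom.appLE ⊤ ⊤ (by rw [Scheme.Hom.preimage_top]) t) = σ (e t))
    (h₀ : NodeAtlas p (⟨ρ, hq⟩ : ActionOver q G) g₀) (𝔄₀ : NodeAtlasData p (GModel.initial hq h₀).act g₀) :
    ∃ P : ∀ M : GModel p q G ρ g₀, NodeAtlasData p M.act g₀ → Prop,
      P (GModel.initial hq h₀) 𝔄₀ ∧ ∀ (M : GModel p q G ρ g₀) (𝔄 : NodeAtlasData p M.act g₀), P M 𝔄 → ¬ M.Terminal →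
        ∃ n : ℕ, TreeF P (fun N 𝔅 => LexLTF N 𝔅 M 𝔄) n M 𝔄 :=
  exists_reachLowerF_of_terminal _ 𝔄₀
    (terminal_initial_of_isPrincipal_augmentationIdeal_of_pow hG hg₀ hq σ hC hp hI e he h₀)

/-! ## Appendix (leafhand-res-wildquotients-9 g1, same session): the principal rank-2 translation is `KillsIn 0` too -/

/-- **The augmentation ideal of a rank-2 translation with principal direction ideal is principal**: σ fixing constants and `x₀, x₁`,
`x₂ ↦ x₂ + ε(H f′)`, `x₃ ↦ x₃ + ε(H g′)` with `α f′ + β g′ = 1` ⇒ `augmentationIdeal σ = (ε H)`. [folklore] -/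
theorem augmentationIdeal_translationRankTwo_eq_span {k : Type} [Field k] (H f' g' α β : MvPolynomial (Fin 2) k) (hbez : α * f' + β * g' = 1)
    (σ : MvPolynomial (Fin 4) k ≃+* MvPolynomial (Fin 4) k) (hC : ∀ a : k, σ (C a) = C a)
    (h0 : σ (X 0) = X 0) (h1 : σ (X 1) = X 1)
    (h2 : σ (X 2) = X 2 + rename (Fin.castLE (by decide : 2 ≤ 4)) (H * f'))
    (h3 : σ (X 3) = X 3 + rename (Fin.castLE (by decide : 2 ≤ 4)) (H * g')) :
    augmentationIdeal σ = Ideal.span {rename (Fin.castLE (by decide : 2 ≤ 4)) H} := by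
  set ε : MvPolynomial (Fin 2) k →ₐ[k] MvPolynomial (Fin 4) k := rename (Fin.castLE (by decide : 2 ≤ 4)) with hε
  apply le_antisymm
  · refine TranslationClass.augmentationIdeal_le_of_generators σ _ (Set.range (C : k → MvPolynomial (Fin 4) k) ∪ Set.range X) ?_ ?_
    · have h := Algebra.adjoin_eq_ring_closure (R := k) (Set.range (X : Fin 4 → MvPolynomial (Fin 4) k))
      rw [adjoin_range_X] at h
      rw [← show (algebraMap k (MvPolynomial (Fin 4) k) : k → MvPolynomial (Fin 4) k) = C from rfl, ← h]
      rfl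
    · rintro _ (⟨a, rfl⟩ | ⟨i, rfl⟩)
      · rw [hC, sub_self]; exact Ideal.zero_mem _
      · fin_cases i
        · change σ (X 0) - X 0 ∈ _; rw [h0, sub_self]; exact Ideal.zero_mem _
        · change σ (X 1) - X 1 ∈ _; rw [h1, sub_self]; exact Ideal.zero_mem _
        · change σ (X 2) - X 2 ∈ _; rw [h2, add_sub_cancel_left, map_mul]
          exact Ideal.mul_mem_right _ _ (Ideal.mem_span_singleton_self _)
        · change σ (X 3) - X 3 ∈ _; rw [h3, add_sub_cancel_left, map_mul]
          exact Ideal.mul_mem_right _ _ (Ideal.mem_span_singleton_self _)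
  · rw [Ideal.span_le, Set.singleton_subset_iff, SetLike.mem_coe]
    have hbez' : ε α * ε f' + ε β * ε g' = 1 := by rw [← map_mul, ← map_mul, ← map_add, hbez, map_one]
    have e1 : ε H = ε α * (σ (X 2) - X 2) + ε β * (σ (X 3) - X 3) := by
      rw [h2, h3, add_sub_cancel_left, add_sub_cancel_left, map_mul, map_mul]
      linear_combination (-(ε H)) * hbez'
    rw [e1]
    exact Ideal.add_mem _ (Ideal.mul_mem_left _ _ (sub_mem_augmentationIdeal σ _)) (Ideal.mul_mem_left _ _ (sub_mem_augmentationIdeal σ _))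

/-- ★ **The rank-2 translation with PRINCIPAL direction ideal is `KillsIn 0`** (census coordinates, `g₀ ^ p = 1`): companion of
✓`translationRankTwo_terminal_initial` in the `F = ∅` sense. [OURS · L1 W4.5c · class `r = 0` translation, rank 2; NOT a statement of the manuscript] -/
theorem translationRankTwo_killsIn_zero [Finite G] (hG : ∀ g : G, g ∈ Subgroup.zpowers g₀) (hg₀ : g₀ ^ p = 1)
    (hq : ∀ g : G, (ρ g).hom ≫ q = q) [IsIntegral X'] [IsLocallyNoetherian X'] [IsAffine X'] [IsAffineHom q]
    {k : Type} [Field k] (H f' g' α β : MvPolynomial (Fin 2) k) (hbez : α * f' + β * g' = 1)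
    (σ : MvPolynomial (Fin 4) k ≃+* MvPolynomial (Fin 4) k) (hC : ∀ a : k, σ (C a) = C a)
    (h0 : σ (X 0) = X 0) (h1 : σ (X 1) = X 1)
    (h2 : σ (X 2) = X 2 + rename (Fin.castLE (by decide : 2 ≤ 4)) (H * f'))
    (h3 : σ (X 3) = X 3 + rename (Fin.castLE (by decide : 2 ≤ 4)) (H * g'))
    (e : Γ(X', ⊤) ≃+* MvPolynomial (Fin 4) k)
    (he : ∀ t : Γ(X', ⊤), e ((ρ g₀⁻¹).hom.appLE ⊤ ⊤ (by rw [Scheme.Hom.preimage_top]) t) = σ (e t))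
    (h₀ : NodeAtlas p (⟨ρ, hq⟩ : ActionOver q G) g₀) :
    KillsIn 0 (GModel.initial (p := p) (g₀ := g₀) hq h₀) :=
  killsIn_zero_initial_of_isPrincipal_augmentationIdeal_of_pow hG hg₀ hq σ
    ⟨⟨rename (Fin.castLE (by decide : 2 ≤ 4)) H, augmentationIdeal_translationRankTwo_eq_span H f' g' α β hbez σ hC h0 h1 h2 h3⟩⟩ e he h₀

/-! ## Appendix 2 (leafhand-res-wildquotients-9 g1, same session): THE DEPTH-0 CLASS in census language — PRINCIPAL ROW IDEAL

For ANY `σ` on `k[x_ι]` fixing constants whose ROWS `σ xᵢ − xᵢ = H·cᵢ` share a factor `H` with `(cᵢ)ᵢ` unimodular (`Σ aᵢ cᵢ = 1`), the augmentation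
ideal is `(H)` (generators lemma ✓`TranslationClass.augmentationIdeal_le_of_generators` + Bézout), so — with `g₀ ^ p = 1` — the initial model is
`KillsIn 0` AND `Terminal`. This subsumes the translation class (`H = F`, `c = e_n`), the principal rank-2 translations, and non-translation data such as
`σ = (x₀, x₁ + x₀, x₂ + x₀x₁)` (`H = x₀`, `c = (0, 1, x₁)`; order `p` for `p` odd): the fixed scheme `V(H)` is a Cartier divisor. -/

/-- **PRINCIPAL ROW IDEAL ⇒ principal augmentation ideal**: `σ (X i) − X i = H * c i` for all `i` and `Σ aᵢ cᵢ = 1` ⇒ `augmentationIdeal σ = (H)`.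
[folklore] -/
theorem augmentationIdeal_eq_span_of_rows {k : Type} [Field k] {ι : Type} [Fintype ι] (σ : MvPolynomial ι k ≃+* MvPolynomial ι k)
    (hC : ∀ a : k, σ (C a) = C a) (H : MvPolynomial ι k) (c a : ι → MvPolynomial ι k)
    (hrows : ∀ i, σ (X i) - X i = H * c i) (hbez : ∑ i, a i * c i = 1) :
    augmentationIdeal σ = Ideal.span {H} := by
  apply le_antisymm
  · refine TranslationClass.augmentationIdeal_le_of_generators σ _ (Set.range (C : k → MvPolynomial ι k) ∪ Set.range X) ?_ ?_
    · have h := Algebra.adjoin_eq_ring_closure (R := k) (Set.range (X : ι → MvPolynomial ι k))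
      rw [adjoin_range_X] at h
      rw [← show (algebraMap k (MvPolynomial ι k) : k → MvPolynomial ι k) = C from rfl, ← h]
      rfl
    · rintro _ (⟨b, rfl⟩ | ⟨i, rfl⟩)
      · rw [hC, sub_self]; exact Ideal.zero_mem _
      · rw [hrows]; exact Ideal.mul_mem_right _ _ (Ideal.mem_span_singleton_self H)
  · rw [Ideal.span_le, Set.singleton_subset_iff, SetLike.mem_coe]
    have e1 : H = ∑ i, a i * (σ (X i) - X i) := by
      simp_rw [hrows]
      calc H = H * ∑ i, a i * c i := by rw [hbez, mul_one]
        _ = ∑ i, a i * (H * c i) := by rw [Finset.mul_sum]; exact Finset.sum_congr rfl fun i _ => by ring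
    rw [e1]
    exact Ideal.sum_mem _ fun i _ => Ideal.mul_mem_left _ _ (sub_mem_augmentationIdeal σ _)

/-- ★★ **THE DEPTH-0 CLASS, `F = ∅` form**: polynomial chart `e : Γ(X′, ⊤) ≃+* k[x_ι]` intertwining `g₀` (`g₀ ^ p = 1`) with `σ` fixing constants whose
rows `σ xᵢ − xᵢ = H·cᵢ` have `(cᵢ)` unimodular ⇒ `KillsIn 0 (initial)`. [OURS · L1 W4.5c · depth-0 class; NOT a statement of the manuscript] -/
theorem rowsPrincipal_killsIn_zero [Finite G] (hG : ∀ g : G, g ∈ Subgroup.zpowers g₀) (hg₀ : g₀ ^ p = 1)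
    (hq : ∀ g : G, (ρ g).hom ≫ q = q) [IsIntegral X'] [IsLocallyNoetherian X'] [IsAffine X'] [IsAffineHom q]
    {k : Type} [Field k] {ι : Type} [Fintype ι] [DecidableEq ι] (σ : MvPolynomial ι k ≃+* MvPolynomial ι k) (hC : ∀ a : k, σ (C a) = C a)
    (H : MvPolynomial ι k) (c a : ι → MvPolynomial ι k) (hrows : ∀ i, σ (X i) - X i = H * c i) (hbez : ∑ i, a i * c i = 1)
    (e : Γ(X', ⊤) ≃+* MvPolynomial ι k)
    (he : ∀ t : Γ(X', ⊤), e ((ρ g₀⁻¹).hom.appLE ⊤ ⊤ (by rw [Scheme.Hom.preimage_top]) t) = σ (e t))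
    (h₀ : NodeAtlas p (⟨ρ, hq⟩ : ActionOver q G) g₀) :
    KillsIn 0 (GModel.initial (p := p) (g₀ := g₀) hq h₀) :=
  killsIn_zero_initial_of_isPrincipal_augmentationIdeal_of_pow hG hg₀ hq σ
    ⟨⟨H, augmentationIdeal_eq_span_of_rows σ hC H c a hrows hbez⟩⟩ e he h₀

/-- ★★ **THE DEPTH-0 CLASS, TERMINAL form** (`p` prime): the same hypotheses ⇒ the initial model is TERMINAL.
[OURS · L1 W4.5c · depth-0 class; NOT a statement of the manuscript] -/
theorem rowsPrincipal_terminal_initial [Finite G] (hG : ∀ g : G, g ∈ Subgroup.zpowers g₀) (hg₀ : g₀ ^ p = 1)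
    (hq : ∀ g : G, (ρ g).hom ≫ q = q) [IsIntegral X'] [IsLocallyNoetherian X'] [IsAffine X'] [IsAffineHom q]
    {k : Type} [Field k] {ι : Type} [Fintype ι] (σ : MvPolynomial ι k ≃+* MvPolynomial ι k) (hC : ∀ a : k, σ (C a) = C a)
    (hp : p.Prime) (H : MvPolynomial ι k) (c a : ι → MvPolynomial ι k) (hrows : ∀ i, σ (X i) - X i = H * c i) (hbez : ∑ i, a i * c i = 1)
    (e : Γ(X', ⊤) ≃+* MvPolynomial ι k)
    (he : ∀ t : Γ(X', ⊤), e ((ρ g₀⁻¹).hom.appLE ⊤ ⊤ (by rw [Scheme.Hom.preimage_top]) t) = σ (e t))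
    (h₀ : NodeAtlas p (⟨ρ, hq⟩ : ActionOver q G) g₀) :
    (GModel.initial (p := p) (g₀ := g₀) hq h₀).Terminal :=
  terminal_initial_of_isPrincipal_augmentationIdeal_of_pow hG hg₀ hq σ hC hp
    ⟨⟨H, augmentationIdeal_eq_span_of_rows σ hC H c a hrows hbez⟩⟩ e he h₀

/-- **… and the research-stub clause** (every root decoration). [OURS · L1 W4.5c · depth-0 class; NOT a statement of the manuscript] -/
theorem exists_reachLowerF_initial_of_rowsPrincipal [Finite G] (hG : ∀ g : G, g ∈ Subgroup.zpowers g₀) (hg₀ : g₀ ^ p = 1)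
    (hq : ∀ g : G, (ρ g).hom ≫ q = q) [IsIntegral X'] [IsLocallyNoetherian X'] [IsAffine X'] [IsAffineHom q]
    {k : Type} [Field k] {ι : Type} [Fintype ι] (σ : MvPolynomial ι k ≃+* MvPolynomial ι k) (hC : ∀ a : k, σ (C a) = C a)
    (hp : p.Prime) (H : MvPolynomial ι k) (c a : ι → MvPolynomial ι k) (hrows : ∀ i, σ (X i) - X i = H * c i) (hbez : ∑ i, a i * c i = 1)
    (e : Γ(X', ⊤) ≃+* MvPolynomial ι k)
    (he : ∀ t : Γ(X', ⊤), e ((ρ g₀⁻¹).hom.appLE ⊤ ⊤ (by rw [Scheme.Hom.preimage_top]) t) = σ (e t))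
    (h₀ : NodeAtlas p (⟨ρ, hq⟩ : ActionOver q G) g₀) (𝔄₀ : NodeAtlasData p (GModel.initial hq h₀).act g₀) :
    ∃ P : ∀ M : GModel p q G ρ g₀, NodeAtlasData p M.act g₀ → Prop,
      P (GModel.initial hq h₀) 𝔄₀ ∧ ∀ (M : GModel p q G ρ g₀) (𝔄 : NodeAtlasData p M.act g₀), P M 𝔄 → ¬ M.Terminal →
        ∃ n : ℕ, TreeF P (fun N 𝔅 => LexLTF N 𝔅 M 𝔄) n M 𝔄 :=
  exists_reachLowerF_of_terminal _ 𝔄₀ (rowsPrincipal_terminal_initial hG hg₀ hq σ hC hp H c a hrows hbez e he h₀)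

/-! ## Appendix 3 (leafhand-res-wildquotients-9 g1, same session): TRANSVECTIONS are depth 0

A transvection `σ xᵢ = xᵢ + vᵢ·φ` (`φ ∈ k[x]` one polynomial — for a genuine transvection a linear form with `φ(v) = 0` —, `v ∈ kⁿ` a non-zero constant
vector) has rows `vᵢ·φ` with `(vᵢ)` unimodular, so its augmentation ideal is `(φ)` and the initial model is `KillsIn 0` and TERMINAL (the tree's
✓`transvection_killsIn_one` spends one move; none is needed). -/

/-- ★ **TRANSVECTIONS ARE DEPTH 0** (`F = ∅` form): `σ (X i) = X i + C (v i) * φ` for all `i` with some `v i₀ ≠ 0`, `g₀ ^ p = 1` ⇒ `KillsIn 0 (initial)`.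
[OURS · L1 W4.5c · depth-0 class; NOT a statement of the manuscript] -/
theorem transvection_killsIn_zero [Finite G] (hG : ∀ g : G, g ∈ Subgroup.zpowers g₀) (hg₀ : g₀ ^ p = 1)
    (hq : ∀ g : G, (ρ g).hom ≫ q = q) [IsIntegral X'] [IsLocallyNoetherian X'] [IsAffine X'] [IsAffineHom q]
    {k : Type} [Field k] {ι : Type} [Fintype ι] [DecidableEq ι] (σ : MvPolynomial ι k ≃+* MvPolynomial ι k) (hC : ∀ a : k, σ (C a) = C a)
    (φ : MvPolynomial ι k) (v : ι → k) (i₀ : ι) (hv : v i₀ ≠ 0) (hrows : ∀ i, σ (X i) = X i + C (v i) * φ)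
    (e : Γ(X', ⊤) ≃+* MvPolynomial ι k)
    (he : ∀ t : Γ(X', ⊤), e ((ρ g₀⁻¹).hom.appLE ⊤ ⊤ (by rw [Scheme.Hom.preimage_top]) t) = σ (e t))
    (h₀ : NodeAtlas p (⟨ρ, hq⟩ : ActionOver q G) g₀) :
    KillsIn 0 (GModel.initial (p := p) (g₀ := g₀) hq h₀) := by
  classical
  refine rowsPrincipal_killsIn_zero hG hg₀ hq σ hC φ (fun i => C (v i)) (fun i => if i = i₀ then C (v i₀)⁻¹ else 0)
    (fun i => by rw [hrows]; ring) ?_ e he h₀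
  rw [Finset.sum_eq_single i₀ (fun j _ hj => by rw [if_neg hj, zero_mul]) (fun h => absurd (Finset.mem_univ i₀) h), if_pos rfl,
    ← map_mul, inv_mul_cancel₀ hv, map_one]

/-- ★ **TRANSVECTIONS ARE DEPTH 0** (TERMINAL form, `p` prime). [OURS · L1 W4.5c · depth-0 class; NOT a statement of the manuscript] -/
theorem transvection_terminal_initial [Finite G] (hG : ∀ g : G, g ∈ Subgroup.zpowers g₀) (hg₀ : g₀ ^ p = 1)
    (hq : ∀ g : G, (ρ g).hom ≫ q = q) [IsIntegral X'] [IsLocallyNoetherian X'] [IsAffine X'] [IsAffineHom q]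
    {k : Type} [Field k] {ι : Type} [Fintype ι] [DecidableEq ι] (σ : MvPolynomial ι k ≃+* MvPolynomial ι k) (hC : ∀ a : k, σ (C a) = C a)
    (hp : p.Prime) (φ : MvPolynomial ι k) (v : ι → k) (i₀ : ι) (hv : v i₀ ≠ 0) (hrows : ∀ i, σ (X i) = X i + C (v i) * φ)
    (e : Γ(X', ⊤) ≃+* MvPolynomial ι k)
    (he : ∀ t : Γ(X', ⊤), e ((ρ g₀⁻¹).hom.appLE ⊤ ⊤ (by rw [Scheme.Hom.preimage_top]) t) = σ (e t))
    (h₀ : NodeAtlas p (⟨ρ, hq⟩ : ActionOver q G) g₀) :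
    (GModel.initial (p := p) (g₀ := g₀) hq h₀).Terminal := by
  classical
  refine rowsPrincipal_terminal_initial hG hg₀ hq σ hC hp φ (fun i => C (v i)) (fun i => if i = i₀ then C (v i₀)⁻¹ else 0)
    (fun i => by rw [hrows]; ring) ?_ e he h₀
  rw [Finset.sum_eq_single i₀ (fun j _ hj => by rw [if_neg hj, zero_mul]) (fun h => absurd (Finset.mem_univ i₀) h), if_pos rfl,
    ← map_mul, inv_mul_cancel₀ hv, map_one]

end Summit.ResolutionOfSingularities.ResolutionOfSingularities.Theorems.WildQuotientResolution.S1.GameFrame.GModel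

end
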